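import Summits.QuantumFields.YangMills.Theorems.UnitScaleTiltProp7UntwistChartSplit
import Summits.QuantumFields.YangMills.Theorems.UnitScaleTiltProp7PinnedRegaugeChartLipschitz
import Summits.QuantumFields.YangMills.Theorems.UnitScaleTiltProp7ExactCorrectorGaugeSockets
import Literature.MathematicalPhysics.QuantumFieldTheory.Balaban1983to89.B7Eq214FlatQprime
import HarnessLib

/-!
# Route `UnitScaleTilt`, crux K1 «MinimiserStabilityRegPr» (stmt-QuantumFields-19200), route-R E′ path (α′), (E1) «pinned slice theorem» — its STARTING POINT (row R2 ∕ (F1′)):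
# THE CHART OF A RE-GAUGED LANDAU REPRESENTATIVE, `D‴ = −i·log((X^g)_b·W_b⁻¹)` for `X = e^{iA₀}W` and ANY gauge `g` — sup row, Hermitian-traceless, and the DIVERGENCE TRANSFER
# `‖divB 𝒰 D‴‖ ≤ ‖divB 𝒰 A₀‖ + ‖divB 𝒰 G‖ + d·(2qs + 4sγ)` through the exact split `D‴ = Ad_{g₋}A₀ + G + R₂` (✓ `Prop7UntwistChartSplit`), `G` the pure-gauge part of `g`

Cell `ym3-torus`, width seat `ym-ust-19200-w1` (gen 12); LOCATE `LOCATE-F1PRIME-SMOOTH-UNTWIST-w1g12.md` (19200 evidence n = 55), file (U2b).  THEOREMS ONLY (0 `def`, 0 `sorry`);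
`--supports stmt-QuantumFields-19200`, count-neutral.  YM₃ on T³ is a ladder rung (R3), not the Clay problem; nothing here claims a stub, the crux, d = 4 or the mass gap.

WHY.  The (E1) start needs `ℓ²‖divB 𝒰 D‴‖_∞` k-uniform.  In the exact split of ✓ `untwistChart_split_T3` only the pure-gauge part `G` of the untwisting gauge `g` can be rough;
the conjugated Landau field `Ad_{g₋}A₀` has the divergence of `A₀` up to `2‖Q(x−e_μ, μ) − 1‖·‖A₀‖` per direction (`Q = (W^g)W⁻¹`, the commutator of the conjugation with the
backward transport), and the quadratic remainder `R₂` is already `O(‖A₀‖‖G‖) = O(ℓ⁻²)` pointwise, so its divergence is booked crudely.  With `q ⊒ ‖Q − 1‖`, `γ ⊒ ‖G‖` and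
`‖divB 𝒰 G‖` supplied by ✓ `Prop7PureGaugeOfExpRows` for `g = expHerm ∘ φ`, all three rows are k-uniform.  THIS FILE is the `g`-generic algebra.

WHAT IS PROVED (ns `…Theorems.Prop7GaugeActChartRows`; T³ run `F.P K`, level `0`, `W : GaugeField (F.P K) 0 SU(2)`, `𝒰 := fun κ z => unitsField (toUField W) ⟨z, κ⟩`,
`A₀` Hermitian-traceless with `‖A₀ b‖ ≤ s`, `X := emb15 W (expHermField A₀)`, any `g : GaugeTransf`).
* §1 `pertVar_emb15_expHermField` (`Y_b(W, X) = e^{iA₀(b)} − 1`), `norm_pertVar_emb15_le` (`≤ 2s`), `norm_pertVar_gaugeAct_emb15_le` (`‖Y_b(W, X^g)‖ ≤ 2s + ‖Q_b − 1‖`),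
  `chart_gaugeAct_isHermitian_trace` (for `2s + q ≤ 1∕3`), ★ `norm_chart_gaugeAct_le` (`‖D‴ b‖ ≤ s + γ + 2sγ`).
* §2 ★ `norm_conj_transport_comm_le` (`‖W*·(g′Ag′*)·W − g·(W*AW)·g*‖ ≤ 2‖A‖·‖g′Wg*W* − 1‖`), ★★ `norm_divB_conjGauge_le`
  (`‖divB 𝒰 (Ad_{g₋}A₀) x‖ ≤ ‖divB 𝒰 A₀ x‖ + 2·Σ_μ ‖Q(x−e_μ,μ) − 1‖·‖A₀(x−e_μ,μ)‖`), `norm_divB_le_sum` (crude), ★★★ `norm_divB_chart_gaugeAct_le`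
  (`‖divB 𝒰 D‴ x‖ ≤ ‖divB 𝒰 A₀ x‖ + ‖divB 𝒰 G x‖ + d·(2qs + 4sγ)` under `7s + 2(2s + q) ≤ 1∕5`, `s ≤ 1`).
HONEST SCOPE.  Pointwise matrix bookkeeping; `q`, `γ`, `‖divB 𝒰 G‖` are displayed; nothing of Bałaban's beyond (31)∕(15) is asserted.

References: T. Bałaban, CMP 102 (1985) 277–309 [Balaban1985Variational] ((15) p.280, (112) p.294); CMP 98 (1985) 17–51 [Balaban1985Averaging] ((8) p.19, (31) p.22);
CMP 99 (1985) 389–434 [Balaban1985BackgroundPropagators] ((3.8) p.392); CMP 99 (1985) 75–102 [Balaban1985RegularSpaces] ((1.36) p.82).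
-/

set_option autoImplicit false

noncomputable section

open scoped BigOperators Matrix.Norms.L2Operator
open NormedSpace

namespace Summit.QuantumFields.YangMills.Theorems.Prop7GaugeActChartRows

open Literature.MathematicalPhysics.QuantumFieldTheory.Balaban1983to89
open Literature.MathematicalPhysics.QuantumFieldTheory.Balaban1983to89.T3ContinuumYM3Torus
open Literature.MathematicalPhysics.QuantumFieldTheory.Balaban1983to89.T3SectALandauChart (emb15)
open T4Continuum
open B9Eq39Adjoint (R R_def R_add R_sub covD covDstar divB covDstar_add)
open B9Eq310Hermitian (norm_R_le)
open B9TorusCalculus (torusT torusT_apply torusT_symm_apply)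
open B10Eq27TorusAxialLog (unitsField toUField)
open MatrixLog (mlog)
open BlockAveragingEMLLinearisedBackground (pertVar pertVar_eq)
open Summit.QuantumFields.YangMills.Theorems.Prop7TPrint (expHerm expHermField expHermField_apply coe_expHerm)
open Summit.QuantumFields.YangMills.Theorems.Prop7BlendSite (coe_inv_SU)
open Summit.QuantumFields.YangMills.Theorems.Prop7HolRatioPerStep (coe_star_mul_self coe_mul_star_self norm_coe_eq_one norm_star_coe_eq_one)
open Summit.QuantumFields.YangMills.Theorems.Prop7CovIterLambdaBound (norm_conj_su_le)
open Summit.QuantumFields.YangMills.Theorems.Prop7PinnedRegaugeChartBCH (norm_pertVar_gaugeAct_le)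
open Summit.QuantumFields.YangMills.Theorems.Prop7PinnedRegaugeChartLipschitz (norm_conj_sub_conj_le)
open Summit.QuantumFields.YangMills.Theorems.Prop7ExactCorrectorGaugeSockets (unitsField_toUField_norm_le_one)
open Summit.QuantumFields.YangMills.Theorems.Prop7UntwistedChartOfBlend (hermLog_isHermitian hermLog_trace norm_hermLog_le)
open Summit.QuantumFields.YangMills.Theorems.Prop7UntwistChartSplit (untwistChart_split_T3)

variable (F : T3Family) {K : ℕ}

/-! ## §1 Sup row and Hermitian-tracelessness of the chart of `X^g` -/

section Sup

/-- `Y_b(W, e^{iA₀}W) = e^{iA₀(b)} − 1` for Hermitian-traceless `A₀`. [cite: Balaban1985Variational, (15) p.280, (112) p.294] -/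
theorem pertVar_emb15_expHermField (W : GaugeField (F.P K) 0 (Matrix.specialUnitaryGroup (Fin 2) ℂ)) (A₀ : PBond (F.P K) 0 → Matrix (Fin 2) (Fin 2) ℂ)
    (hA : ∀ b, (A₀ b).IsHermitian ∧ Matrix.trace (A₀ b) = 0) (b : PBond (F.P K) 0) :
    pertVar W (emb15 W (expHermField A₀)) b = exp (Complex.I • A₀ b) - 1 := by
  rw [pertVar_eq]
  show ((expHerm (A₀ b) * W b : Matrix.specialUnitaryGroup (Fin 2) ℂ) : Matrix (Fin 2) (Fin 2) ℂ) * star ((W b : Matrix.specialUnitaryGroup (Fin 2) ℂ) : Matrix (Fin 2) (Fin 2) ℂ) - 1 = _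
  rw [Submonoid.coe_mul, mul_assoc, coe_mul_star_self, mul_one, coe_expHerm (hA b)]

/-- `‖Y_b(W, e^{iA₀}W)‖ ≤ 2s` for `‖A₀ b‖ ≤ s ≤ 1`. [cite: Balaban1985Variational, (15) p.280; Balaban1985Averaging, (24) p.21] -/
theorem norm_pertVar_emb15_le (W : GaugeField (F.P K) 0 (Matrix.specialUnitaryGroup (Fin 2) ℂ)) (A₀ : PBond (F.P K) 0 → Matrix (Fin 2) (Fin 2) ℂ)
    (hA : ∀ b, (A₀ b).IsHermitian ∧ Matrix.trace (A₀ b) = 0) {s : ℝ} (hs : ∀ b, ‖A₀ b‖ ≤ s) (hs1 : s ≤ 1) (b : PBond (F.P K) 0) :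
    ‖pertVar W (emb15 W (expHermField A₀)) b‖ ≤ 2 * s := by
  rw [pertVar_emb15_expHermField F W A₀ hA b]
  refine B7Eq214FlatQprime.norm_exp_sub_one_le_two_mul ?_ hs1
  rw [norm_smul, Complex.norm_I, one_mul]; exact hs b

/-- **`g₋ − W_b·g₊·W_b* = (Q_b − 1)·(W_b·g₊·W_b*)`**, so `‖g₋ − W_b g₊ W_b*‖ ≤ ‖Q_b − 1‖` with `Q_b = g₋W_bg₊*W_b*`. [cite: Balaban1985Averaging, (8) p.19] -/
theorem norm_gauge_sub_conj_le (gm gp Wb : Matrix.specialUnitaryGroup (Fin 2) ℂ) :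
    ‖(gm : Matrix (Fin 2) (Fin 2) ℂ) - (Wb : Matrix (Fin 2) (Fin 2) ℂ) * (gp : Matrix (Fin 2) (Fin 2) ℂ) * star (Wb : Matrix (Fin 2) (Fin 2) ℂ)‖
      ≤ ‖(gm : Matrix (Fin 2) (Fin 2) ℂ) * (Wb : Matrix (Fin 2) (Fin 2) ℂ) * star (gp : Matrix (Fin 2) (Fin 2) ℂ) * star (Wb : Matrix (Fin 2) (Fin 2) ℂ) - 1‖ := by
  have h1 : star (Wb : Matrix (Fin 2) (Fin 2) ℂ) * (Wb : Matrix (Fin 2) (Fin 2) ℂ) = 1 := coe_star_mul_self Wb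
  have h2 : (Wb : Matrix (Fin 2) (Fin 2) ℂ) * star (Wb : Matrix (Fin 2) (Fin 2) ℂ) = 1 := coe_mul_star_self Wb
  have h3 : star (gp : Matrix (Fin 2) (Fin 2) ℂ) * (gp : Matrix (Fin 2) (Fin 2) ℂ) = 1 := coe_star_mul_self gp
  have e : (gm : Matrix (Fin 2) (Fin 2) ℂ) - (Wb : Matrix (Fin 2) (Fin 2) ℂ) * (gp : Matrix (Fin 2) (Fin 2) ℂ) * star (Wb : Matrix (Fin 2) (Fin 2) ℂ)
      = ((gm : Matrix (Fin 2) (Fin 2) ℂ) * (Wb : Matrix (Fin 2) (Fin 2) ℂ) * star (gp : Matrix (Fin 2) (Fin 2) ℂ) * star (Wb : Matrix (Fin 2) (Fin 2) ℂ) - 1)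
          * ((Wb : Matrix (Fin 2) (Fin 2) ℂ) * (gp : Matrix (Fin 2) (Fin 2) ℂ) * star (Wb : Matrix (Fin 2) (Fin 2) ℂ)) := by
    rw [sub_mul, one_mul]
    congr 1
    simp only [← mul_assoc]
    rw [mul_assoc ((gm : Matrix (Fin 2) (Fin 2) ℂ) * (Wb : Matrix (Fin 2) (Fin 2) ℂ) * star (gp : Matrix (Fin 2) (Fin 2) ℂ)) (star (Wb : Matrix (Fin 2) (Fin 2) ℂ)) (Wb : Matrix (Fin 2) (Fin 2) ℂ), h1, mul_one,
      mul_assoc ((gm : Matrix (Fin 2) (Fin 2) ℂ) * (Wb : Matrix (Fin 2) (Fin 2) ℂ)) (star (gp : Matrix (Fin 2) (Fin 2) ℂ)) (gp : Matrix (Fin 2) (Fin 2) ℂ), h3, mul_one, mul_assoc, h2, mul_one]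
  rw [e]
  refine (norm_mul_le _ _).trans ?_
  have hn : ‖(Wb : Matrix (Fin 2) (Fin 2) ℂ) * (gp : Matrix (Fin 2) (Fin 2) ℂ) * star (Wb : Matrix (Fin 2) (Fin 2) ℂ)‖ ≤ 1 := by
    have := norm_coe_eq_one (Wb * gp * Wb⁻¹)
    rw [Submonoid.coe_mul, Submonoid.coe_mul, coe_inv_SU] at this
    exact this.le
  calc ‖(gm : Matrix (Fin 2) (Fin 2) ℂ) * (Wb : Matrix (Fin 2) (Fin 2) ℂ) * star (gp : Matrix (Fin 2) (Fin 2) ℂ) * star (Wb : Matrix (Fin 2) (Fin 2) ℂ) - 1‖ * ‖(Wb : Matrix (Fin 2) (Fin 2) ℂ) * (gp : Matrix (Fin 2) (Fin 2) ℂ) * star (Wb : Matrix (Fin 2) (Fin 2) ℂ)‖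
      ≤ ‖(gm : Matrix (Fin 2) (Fin 2) ℂ) * (Wb : Matrix (Fin 2) (Fin 2) ℂ) * star (gp : Matrix (Fin 2) (Fin 2) ℂ) * star (Wb : Matrix (Fin 2) (Fin 2) ℂ) - 1‖ * 1 := mul_le_mul_of_nonneg_left hn (norm_nonneg _)
    _ = _ := mul_one _

variable (W : GaugeField (F.P K) 0 (Matrix.specialUnitaryGroup (Fin 2) ℂ)) (A₀ : PBond (F.P K) 0 → Matrix (Fin 2) (Fin 2) ℂ)
  (hA : ∀ b, (A₀ b).IsHermitian ∧ Matrix.trace (A₀ b) = 0) (g : GaugeTransf (F.P K) 0 (Matrix.specialUnitaryGroup (Fin 2) ℂ))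
include hA

/-- **CHART SUP OF `X^g` FROM THE RATIO**: `‖Y_b(W, X^g)‖ ≤ 2s + ‖Q_b − 1‖`, `Q_b = (W^g)_bW_b⁻¹`. [cite: Balaban1985Variational, (15) p.280; Balaban1985Averaging, (8) p.19] -/
theorem norm_pertVar_gaugeAct_emb15_le {s : ℝ} (hs : ∀ b, ‖A₀ b‖ ≤ s) (hs1 : s ≤ 1) (b : PBond (F.P K) 0) :
    ‖pertVar W (GaugeField.gaugeAct g (emb15 W (expHermField A₀))) b‖
      ≤ 2 * s + ‖((GaugeField.gaugeAct g W b * (W b)⁻¹ : Matrix.specialUnitaryGroup (Fin 2) ℂ) : Matrix (Fin 2) (Fin 2) ℂ) - 1‖ := by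
  have hcoe : ((GaugeField.gaugeAct g W b * (W b)⁻¹ : Matrix.specialUnitaryGroup (Fin 2) ℂ) : Matrix (Fin 2) (Fin 2) ℂ)
      = ((g b.src : Matrix.specialUnitaryGroup (Fin 2) ℂ) : Matrix (Fin 2) (Fin 2) ℂ) * ((W b : Matrix.specialUnitaryGroup (Fin 2) ℂ) : Matrix (Fin 2) (Fin 2) ℂ)
          * star ((g b.tgt : Matrix.specialUnitaryGroup (Fin 2) ℂ) : Matrix (Fin 2) (Fin 2) ℂ) * star ((W b : Matrix.specialUnitaryGroup (Fin 2) ℂ) : Matrix (Fin 2) (Fin 2) ℂ) := by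
    show (((g b.src * W b * (g b.tgt)⁻¹) * (W b)⁻¹ : Matrix.specialUnitaryGroup (Fin 2) ℂ) : Matrix (Fin 2) (Fin 2) ℂ) = _
    rw [Submonoid.coe_mul, Submonoid.coe_mul, Submonoid.coe_mul, coe_inv_SU, coe_inv_SU]
  rw [hcoe]
  exact (norm_pertVar_gaugeAct_le W _ g b).trans (add_le_add (norm_pertVar_emb15_le F W A₀ hA hs hs1 b) (norm_gauge_sub_conj_le (g b.src) (g b.tgt) (W b)))

/-- `D‴_b` is Hermitian and traceless once `2s + ‖Q_b − 1‖ ≤ 1∕3`. [cite: Balaban1985Averaging, (19)-(21) p.21] -/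
theorem chart_gaugeAct_isHermitian_trace {s q : ℝ} (hs : ∀ b, ‖A₀ b‖ ≤ s) (hs1 : s ≤ 1)
    (hq : ∀ b : PBond (F.P K) 0, ‖((GaugeField.gaugeAct g W b * (W b)⁻¹ : Matrix.specialUnitaryGroup (Fin 2) ℂ) : Matrix (Fin 2) (Fin 2) ℂ) - 1‖ ≤ q) (hw : 2 * s + q ≤ 1 / 3)
    (b : PBond (F.P K) 0) :
    ((-Complex.I) • mlog ((GaugeField.gaugeAct g (emb15 W (expHermField A₀)) b * (W b)⁻¹ : Matrix.specialUnitaryGroup (Fin 2) ℂ) : Matrix (Fin 2) (Fin 2) ℂ)).IsHermitian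
    ∧ Matrix.trace ((-Complex.I) • mlog ((GaugeField.gaugeAct g (emb15 W (expHermField A₀)) b * (W b)⁻¹ : Matrix.specialUnitaryGroup (Fin 2) ℂ) : Matrix (Fin 2) (Fin 2) ℂ)) = 0 := by
  set Q : Matrix.specialUnitaryGroup (Fin 2) ℂ := GaugeField.gaugeAct g (emb15 W (expHermField A₀)) b * (W b)⁻¹ with hQ
  have hQ1 : (Q : Matrix (Fin 2) (Fin 2) ℂ) - 1 = pertVar W (GaugeField.gaugeAct g (emb15 W (expHermField A₀))) b := by
    rw [pertVar_eq, hQ, Submonoid.coe_mul, coe_inv_SU]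
  have hQ3 : ‖(Q : Matrix (Fin 2) (Fin 2) ℂ) - 1‖ ≤ 1 / 3 := by
    rw [hQ1]; exact (norm_pertVar_gaugeAct_emb15_le F W A₀ hA g hs hs1 b).trans ((add_le_add le_rfl (hq b)).trans hw)
  have hQm := Matrix.mem_specialUnitaryGroup_iff.1 Q.2
  exact ⟨hermLog_isHermitian hQm.1 hQ3, hermLog_trace hQm.2 hQ3⟩

/-- ★ **SUP ROW OF THE CHART**: `‖D‴ b‖ ≤ s + γ + 2sγ` from the split `D‴ = Ad_{g₋}A₀ + G + R₂`, `‖R₂‖ ≤ 2‖A₀‖‖G‖`, with `‖G‖ ≤ γ`, `‖Q − 1‖ ≤ q`, window `7s + 2(2s+q) ≤ 1∕5`.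
[cite: Balaban1985Averaging, (31) p.22; Balaban1985Variational, (15) p.280; Balaban1985RegularSpaces, (1.36) p.82] -/
theorem norm_chart_gaugeAct_le {s q γ : ℝ} (hs : ∀ b, ‖A₀ b‖ ≤ s) (hs1 : s ≤ 1)
    (hq : ∀ b : PBond (F.P K) 0, ‖((GaugeField.gaugeAct g W b * (W b)⁻¹ : Matrix.specialUnitaryGroup (Fin 2) ℂ) : Matrix (Fin 2) (Fin 2) ℂ) - 1‖ ≤ q)
    (hγ : ∀ b : PBond (F.P K) 0, ‖(-Complex.I) • mlog ((GaugeField.gaugeAct g W b * (W b)⁻¹ : Matrix.specialUnitaryGroup (Fin 2) ℂ) : Matrix (Fin 2) (Fin 2) ℂ)‖ ≤ γ)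
    (hw : 7 * s + 2 * (2 * s + q) ≤ 1 / 5) (b : PBond (F.P K) 0) :
    ‖(-Complex.I) • mlog ((GaugeField.gaugeAct g (emb15 W (expHermField A₀)) b * (W b)⁻¹ : Matrix.specialUnitaryGroup (Fin 2) ℂ) : Matrix (Fin 2) (Fin 2) ℂ)‖
      ≤ s + γ + 2 * s * γ := by
  have hs' : ∀ b, ‖pertVar W (GaugeField.gaugeAct g (emb15 W (expHermField A₀))) b‖ ≤ 2 * s + q :=
    fun b => (norm_pertVar_gaugeAct_emb15_le F W A₀ hA g hs hs1 b).trans (add_le_add le_rfl (hq b))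
  obtain ⟨hsplit, -⟩ := untwistChart_split_T3 (F := F) W A₀ hA hs g hs' hw b
  have hs0 : 0 ≤ s := (norm_nonneg _).trans (hs b)
  have hγ0 : 0 ≤ γ := (norm_nonneg _).trans (hγ b)
  have hAd : ‖((g b.src : Matrix.specialUnitaryGroup (Fin 2) ℂ) : Matrix (Fin 2) (Fin 2) ℂ) * A₀ b * star ((g b.src : Matrix.specialUnitaryGroup (Fin 2) ℂ) : Matrix (Fin 2) (Fin 2) ℂ)‖ ≤ s :=
    (norm_conj_su_le _ _).trans (hs b)
  have hR2 : 2 * ‖A₀ b‖ * ‖(-Complex.I) • mlog ((GaugeField.gaugeAct g W b * (W b)⁻¹ : Matrix.specialUnitaryGroup (Fin 2) ℂ) : Matrix (Fin 2) (Fin 2) ℂ)‖ ≤ 2 * s * γ :=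
    mul_le_mul (mul_le_mul_of_nonneg_left (hs b) (by norm_num)) (hγ b) (norm_nonneg _) (by positivity)
  have htri := norm_le_insert'
    ((-Complex.I) • mlog ((GaugeField.gaugeAct g (emb15 W (expHermField A₀)) b * (W b)⁻¹ : Matrix.specialUnitaryGroup (Fin 2) ℂ) : Matrix (Fin 2) (Fin 2) ℂ))
    (((g b.src : Matrix.specialUnitaryGroup (Fin 2) ℂ) : Matrix (Fin 2) (Fin 2) ℂ) * A₀ b * star ((g b.src : Matrix.specialUnitaryGroup (Fin 2) ℂ) : Matrix (Fin 2) (Fin 2) ℂ)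
      + (-Complex.I) • mlog ((GaugeField.gaugeAct g W b * (W b)⁻¹ : Matrix.specialUnitaryGroup (Fin 2) ℂ) : Matrix (Fin 2) (Fin 2) ℂ))
  have hsum := norm_add_le (((g b.src : Matrix.specialUnitaryGroup (Fin 2) ℂ) : Matrix (Fin 2) (Fin 2) ℂ) * A₀ b * star ((g b.src : Matrix.specialUnitaryGroup (Fin 2) ℂ) : Matrix (Fin 2) (Fin 2) ℂ))
    ((-Complex.I) • mlog ((GaugeField.gaugeAct g W b * (W b)⁻¹ : Matrix.specialUnitaryGroup (Fin 2) ℂ) : Matrix (Fin 2) (Fin 2) ℂ))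
  linarith [hsplit, hAd, hR2, htri, hsum, hγ b]

end Sup

/-! ## §2 The divergence transfer -/

section Divergence

/-- ★ **THE CONJUGATION–TRANSPORT COMMUTATOR**: `‖W*·(g′·A·g′*)·W − g·(W*·A·W)·g*‖ ≤ 2‖A‖·‖g′·W·g*·W* − 1‖` for `g, g′, W ∈ SU(2)` — the transported conjugated field
versus the conjugated transported field differ by the commutator of `A` with the ratio `Q′ = g′Wg*W*` (i.e. `(W^g)(b′)W(b′)⁻¹` for the arriving bond).
[cite: Balaban1985Averaging, (8) p.19; Balaban1985BackgroundPropagators, (3.8) p.392] -/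
theorem norm_conj_transport_comm_le (g g' Wb : Matrix.specialUnitaryGroup (Fin 2) ℂ) (A : Matrix (Fin 2) (Fin 2) ℂ) :
    ‖star (Wb : Matrix (Fin 2) (Fin 2) ℂ) * (((g' : Matrix.specialUnitaryGroup (Fin 2) ℂ) : Matrix (Fin 2) (Fin 2) ℂ) * A * star ((g' : Matrix.specialUnitaryGroup (Fin 2) ℂ) : Matrix (Fin 2) (Fin 2) ℂ)) * (Wb : Matrix (Fin 2) (Fin 2) ℂ)
        - (g : Matrix (Fin 2) (Fin 2) ℂ) * (star (Wb : Matrix (Fin 2) (Fin 2) ℂ) * A * (Wb : Matrix (Fin 2) (Fin 2) ℂ)) * star (g : Matrix (Fin 2) (Fin 2) ℂ)‖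
      ≤ 2 * ‖A‖ * ‖(g' : Matrix (Fin 2) (Fin 2) ℂ) * (Wb : Matrix (Fin 2) (Fin 2) ℂ) * star (g : Matrix (Fin 2) (Fin 2) ℂ) * star (Wb : Matrix (Fin 2) (Fin 2) ℂ) - 1‖ := by
  -- pull `W*( · )W` out: the difference is `W*·[g′Ag′* − hAh*]·W` with `h = WgW*`
  have h1 : star (Wb : Matrix (Fin 2) (Fin 2) ℂ) * (Wb : Matrix (Fin 2) (Fin 2) ℂ) = 1 := coe_star_mul_self Wb
  have key : star (Wb : Matrix (Fin 2) (Fin 2) ℂ) * (((Wb * g * Wb⁻¹ : Matrix.specialUnitaryGroup (Fin 2) ℂ) : Matrix (Fin 2) (Fin 2) ℂ) * A * star ((Wb * g * Wb⁻¹ : Matrix.specialUnitaryGroup (Fin 2) ℂ) : Matrix (Fin 2) (Fin 2) ℂ)) * (Wb : Matrix (Fin 2) (Fin 2) ℂ)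
      = (g : Matrix (Fin 2) (Fin 2) ℂ) * (star (Wb : Matrix (Fin 2) (Fin 2) ℂ) * A * (Wb : Matrix (Fin 2) (Fin 2) ℂ)) * star (g : Matrix (Fin 2) (Fin 2) ℂ) := by
    simp only [Submonoid.coe_mul, coe_inv_SU, star_mul, star_star, ← mul_assoc]
    rw [h1, one_mul, mul_assoc _ (star (Wb : Matrix (Fin 2) (Fin 2) ℂ)) (Wb : Matrix (Fin 2) (Fin 2) ℂ), h1, mul_one]
  have e : star (Wb : Matrix (Fin 2) (Fin 2) ℂ) * (((g' : Matrix.specialUnitaryGroup (Fin 2) ℂ) : Matrix (Fin 2) (Fin 2) ℂ) * A * star ((g' : Matrix.specialUnitaryGroup (Fin 2) ℂ) : Matrix (Fin 2) (Fin 2) ℂ)) * (Wb : Matrix (Fin 2) (Fin 2) ℂ)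
        - (g : Matrix (Fin 2) (Fin 2) ℂ) * (star (Wb : Matrix (Fin 2) (Fin 2) ℂ) * A * (Wb : Matrix (Fin 2) (Fin 2) ℂ)) * star (g : Matrix (Fin 2) (Fin 2) ℂ)
      = ((Wb⁻¹ : Matrix.specialUnitaryGroup (Fin 2) ℂ) : Matrix (Fin 2) (Fin 2) ℂ)
          * (((g' : Matrix.specialUnitaryGroup (Fin 2) ℂ) : Matrix (Fin 2) (Fin 2) ℂ) * A * star ((g' : Matrix.specialUnitaryGroup (Fin 2) ℂ) : Matrix (Fin 2) (Fin 2) ℂ)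
              - ((Wb * g * Wb⁻¹ : Matrix.specialUnitaryGroup (Fin 2) ℂ) : Matrix (Fin 2) (Fin 2) ℂ) * A * star ((Wb * g * Wb⁻¹ : Matrix.specialUnitaryGroup (Fin 2) ℂ) : Matrix (Fin 2) (Fin 2) ℂ))
          * star ((Wb⁻¹ : Matrix.specialUnitaryGroup (Fin 2) ℂ) : Matrix (Fin 2) (Fin 2) ℂ) := by
    rw [← key, coe_inv_SU, star_star, mul_sub, sub_mul]
  rw [e]
  refine (norm_conj_su_le (Wb⁻¹) _).trans ?_
  refine (norm_conj_sub_conj_le g' (Wb * g * Wb⁻¹) A A).trans ?_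
  rw [sub_self, norm_zero, mul_zero, add_zero]
  refine mul_le_mul_of_nonneg_left ?_ (by positivity)
  have := norm_gauge_sub_conj_le g' g Wb
  rw [Submonoid.coe_mul, Submonoid.coe_mul, coe_inv_SU]
  exact this

variable (W : GaugeField (F.P K) 0 (Matrix.specialUnitaryGroup (Fin 2) ℂ)) (A₀ : PBond (F.P K) 0 → Matrix (Fin 2) (Fin 2) ℂ)
  (g : GaugeTransf (F.P K) 0 (Matrix.specialUnitaryGroup (Fin 2) ℂ))

/-- ★★ **DIVERGENCE OF THE CONJUGATED FIELD**: `‖divB 𝒰 (Ad_{g₋}A₀) x‖ ≤ ‖divB 𝒰 A₀ x‖ + 2·Σ_μ ‖Q(x−e_μ, μ) − 1‖·‖A₀(x−e_μ, μ)‖` — the divergence of `A₀` conjugated by `g(x)`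
plus one commutator per arriving bond. [cite: Balaban1985BackgroundPropagators, (3.8) p.392; Balaban1985Averaging, (8) p.19] -/
theorem norm_divB_conjGauge_le (x : Site (F.P K) 0) :
    ‖divB (torusT (F.P K) 0) (fun κ z => unitsField (toUField W) ⟨z, κ⟩)
        (fun μ z => ((g z : Matrix.specialUnitaryGroup (Fin 2) ℂ) : Matrix (Fin 2) (Fin 2) ℂ) * A₀ ⟨z, μ⟩ * star ((g z : Matrix.specialUnitaryGroup (Fin 2) ℂ) : Matrix (Fin 2) (Fin 2) ℂ)) x‖
      ≤ ‖divB (torusT (F.P K) 0) (fun κ z => unitsField (toUField W) ⟨z, κ⟩) (fun μ z => A₀ ⟨z, μ⟩) x‖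
        + 2 * ∑ μ : Fin (F.P K).d, ‖((GaugeField.gaugeAct g W ⟨(torusT (F.P K) 0 μ).symm x, μ⟩ * (W ⟨(torusT (F.P K) 0 μ).symm x, μ⟩)⁻¹ : Matrix.specialUnitaryGroup (Fin 2) ℂ) : Matrix (Fin 2) (Fin 2) ℂ) - 1‖
            * ‖A₀ ⟨(torusT (F.P K) 0 μ).symm x, μ⟩‖ := by
  have hx : ∀ μ : Fin (F.P K).d, torusT (F.P K) 0 μ ((torusT (F.P K) 0 μ).symm x) = x := fun μ => Equiv.apply_symm_apply _ _
  have hval : ∀ b : PBond (F.P K) 0, (((unitsField (toUField W) b)⁻¹ : (Matrix (Fin 2) (Fin 2) ℂ)ˣ) : Matrix (Fin 2) (Fin 2) ℂ) = star ((W b : Matrix.specialUnitaryGroup (Fin 2) ℂ) : Matrix (Fin 2) (Fin 2) ℂ) := by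
    intro b
    show (((Unitary.toUnits (B10Eq27TorusAxialLog.suIncl (W b)))⁻¹ : (Matrix (Fin 2) (Fin 2) ℂ)ˣ) : Matrix (Fin 2) (Fin 2) ℂ) = _
    rw [← map_inv]; rfl
  have hRinv : ∀ (b : PBond (F.P K) 0) (X : Matrix (Fin 2) (Fin 2) ℂ), R ((unitsField (toUField W) b)⁻¹) X
      = star ((W b : Matrix.specialUnitaryGroup (Fin 2) ℂ) : Matrix (Fin 2) (Fin 2) ℂ) * X * ((W b : Matrix.specialUnitaryGroup (Fin 2) ℂ) : Matrix (Fin 2) (Fin 2) ℂ) := by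
    intro b X; rw [R_def, inv_inv, hval]; rfl
  -- the divergence of the conjugated field = conjugated divergence + the commutator terms
  have hdec : divB (torusT (F.P K) 0) (fun κ z => unitsField (toUField W) ⟨z, κ⟩)
        (fun μ z => ((g z : Matrix.specialUnitaryGroup (Fin 2) ℂ) : Matrix (Fin 2) (Fin 2) ℂ) * A₀ ⟨z, μ⟩ * star ((g z : Matrix.specialUnitaryGroup (Fin 2) ℂ) : Matrix (Fin 2) (Fin 2) ℂ)) x
      = ((g x : Matrix.specialUnitaryGroup (Fin 2) ℂ) : Matrix (Fin 2) (Fin 2) ℂ) * divB (torusT (F.P K) 0) (fun κ z => unitsField (toUField W) ⟨z, κ⟩) (fun μ z => A₀ ⟨z, μ⟩) x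
            * star ((g x : Matrix.specialUnitaryGroup (Fin 2) ℂ) : Matrix (Fin 2) (Fin 2) ℂ)
        + ∑ μ : Fin (F.P K).d, (star ((W ⟨(torusT (F.P K) 0 μ).symm x, μ⟩ : Matrix.specialUnitaryGroup (Fin 2) ℂ) : Matrix (Fin 2) (Fin 2) ℂ)
              * (((g ((torusT (F.P K) 0 μ).symm x) : Matrix.specialUnitaryGroup (Fin 2) ℂ) : Matrix (Fin 2) (Fin 2) ℂ) * A₀ ⟨(torusT (F.P K) 0 μ).symm x, μ⟩
                  * star ((g ((torusT (F.P K) 0 μ).symm x) : Matrix.specialUnitaryGroup (Fin 2) ℂ) : Matrix (Fin 2) (Fin 2) ℂ)) * ((W ⟨(torusT (F.P K) 0 μ).symm x, μ⟩ : Matrix.specialUnitaryGroup (Fin 2) ℂ) : Matrix (Fin 2) (Fin 2) ℂ)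
            - ((g x : Matrix.specialUnitaryGroup (Fin 2) ℂ) : Matrix (Fin 2) (Fin 2) ℂ)
              * (star ((W ⟨(torusT (F.P K) 0 μ).symm x, μ⟩ : Matrix.specialUnitaryGroup (Fin 2) ℂ) : Matrix (Fin 2) (Fin 2) ℂ) * A₀ ⟨(torusT (F.P K) 0 μ).symm x, μ⟩
                  * ((W ⟨(torusT (F.P K) 0 μ).symm x, μ⟩ : Matrix.specialUnitaryGroup (Fin 2) ℂ) : Matrix (Fin 2) (Fin 2) ℂ)) * star ((g x : Matrix.specialUnitaryGroup (Fin 2) ℂ) : Matrix (Fin 2) (Fin 2) ℂ)) := by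
    simp only [divB, covDstar, hRinv, Finset.mul_sum, Finset.sum_mul, ← Finset.sum_add_distrib]
    refine Finset.sum_congr rfl fun μ _ => ?_
    noncomm_ring
  rw [hdec, Finset.mul_sum]
  refine (norm_add_le _ _).trans (add_le_add (norm_conj_su_le _ _) ((norm_sum_le _ _).trans (Finset.sum_le_sum fun μ _ => ?_)))
  refine (norm_conj_transport_comm_le (g x) (g ((torusT (F.P K) 0 μ).symm x)) (W ⟨(torusT (F.P K) 0 μ).symm x, μ⟩) _).trans (le_of_eq ?_)
  have hQ : (((g ((torusT (F.P K) 0 μ).symm x)) : Matrix.specialUnitaryGroup (Fin 2) ℂ) : Matrix (Fin 2) (Fin 2) ℂ) * ((W ⟨(torusT (F.P K) 0 μ).symm x, μ⟩ : Matrix.specialUnitaryGroup (Fin 2) ℂ) : Matrix (Fin 2) (Fin 2) ℂ)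
        * star ((g x : Matrix.specialUnitaryGroup (Fin 2) ℂ) : Matrix (Fin 2) (Fin 2) ℂ) * star ((W ⟨(torusT (F.P K) 0 μ).symm x, μ⟩ : Matrix.specialUnitaryGroup (Fin 2) ℂ) : Matrix (Fin 2) (Fin 2) ℂ)
      = ((GaugeField.gaugeAct g W ⟨(torusT (F.P K) 0 μ).symm x, μ⟩ * (W ⟨(torusT (F.P K) 0 μ).symm x, μ⟩)⁻¹ : Matrix.specialUnitaryGroup (Fin 2) ℂ) : Matrix (Fin 2) (Fin 2) ℂ) := by
    show _ = (((g ((torusT (F.P K) 0 μ).symm x) * W ⟨(torusT (F.P K) 0 μ).symm x, μ⟩ * (g (PBond.tgt ⟨(torusT (F.P K) 0 μ).symm x, μ⟩))⁻¹) * (W ⟨(torusT (F.P K) 0 μ).symm x, μ⟩)⁻¹ :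
      Matrix.specialUnitaryGroup (Fin 2) ℂ) : Matrix (Fin 2) (Fin 2) ℂ)
    have htgt : PBond.tgt (⟨(torusT (F.P K) 0 μ).symm x, μ⟩ : PBond (F.P K) 0) = x := hx μ
    rw [htgt, Submonoid.coe_mul, Submonoid.coe_mul, Submonoid.coe_mul, coe_inv_SU, coe_inv_SU]
  rw [hQ]; ring

/-- **CRUDE DIVERGENCE BOUND**: `‖divB 𝒰 B x‖ ≤ Σ_μ (‖B(x−e_μ, μ)‖ + ‖B(x, μ)‖)` at a bi-contractive background. [cite: Balaban1985BackgroundPropagators, (3.8) p.392] -/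
theorem norm_divB_le_sum (B : Fin (F.P K).d → Site (F.P K) 0 → Matrix (Fin 2) (Fin 2) ℂ) (x : Site (F.P K) 0) :
    ‖divB (torusT (F.P K) 0) (fun κ z => unitsField (toUField W) ⟨z, κ⟩) B x‖
      ≤ ∑ μ : Fin (F.P K).d, (‖B μ ((torusT (F.P K) 0 μ).symm x)‖ + ‖B μ x‖) := by
  refine (norm_sum_le _ _).trans (Finset.sum_le_sum fun μ _ => ?_)
  refine (norm_sub_le _ _).trans (add_le_add ?_ le_rfl)
  have hU := unitsField_toUField_norm_le_one W ⟨(torusT (F.P K) 0 μ).symm x, μ⟩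
  exact norm_R_le hU.2 (by rw [inv_inv]; exact hU.1) _

variable (hA : ∀ b, (A₀ b).IsHermitian ∧ Matrix.trace (A₀ b) = 0)
include hA

/-- ★★★ **DIVERGENCE ROW OF THE CHART OF `X^g`**: with `‖A₀‖ ≤ s ≤ 1`, `‖Q − 1‖ ≤ q`, `‖G‖ ≤ γ` and the window `7s + 2(2s + q) ≤ 1∕5`,
`‖divB 𝒰 D‴ x‖ ≤ ‖divB 𝒰 A₀ x‖ + ‖divB 𝒰 G x‖ + d·(2·q·s + 4·s·γ)`. [cite: Balaban1985BackgroundPropagators, (3.8) p.392; Balaban1985Averaging, (31) p.22; Balaban1985RegularSpaces, (1.36) p.82] -/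
theorem norm_divB_chart_gaugeAct_le {s q γ : ℝ} (hs : ∀ b, ‖A₀ b‖ ≤ s) (hs1 : s ≤ 1)
    (hq : ∀ b : PBond (F.P K) 0, ‖((GaugeField.gaugeAct g W b * (W b)⁻¹ : Matrix.specialUnitaryGroup (Fin 2) ℂ) : Matrix (Fin 2) (Fin 2) ℂ) - 1‖ ≤ q)
    (hγ : ∀ b : PBond (F.P K) 0, ‖(-Complex.I) • mlog ((GaugeField.gaugeAct g W b * (W b)⁻¹ : Matrix.specialUnitaryGroup (Fin 2) ℂ) : Matrix (Fin 2) (Fin 2) ℂ)‖ ≤ γ)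
    (hw : 7 * s + 2 * (2 * s + q) ≤ 1 / 5) (x : Site (F.P K) 0) :
    ‖divB (torusT (F.P K) 0) (fun κ z => unitsField (toUField W) ⟨z, κ⟩)
        (fun μ z => (-Complex.I) • mlog ((GaugeField.gaugeAct g (emb15 W (expHermField A₀)) ⟨z, μ⟩ * (W ⟨z, μ⟩)⁻¹ : Matrix.specialUnitaryGroup (Fin 2) ℂ) : Matrix (Fin 2) (Fin 2) ℂ)) x‖
      ≤ ‖divB (torusT (F.P K) 0) (fun κ z => unitsField (toUField W) ⟨z, κ⟩) (fun μ z => A₀ ⟨z, μ⟩) x‖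
        + ‖divB (torusT (F.P K) 0) (fun κ z => unitsField (toUField W) ⟨z, κ⟩)
            (fun μ z => (-Complex.I) • mlog ((GaugeField.gaugeAct g W ⟨z, μ⟩ * (W ⟨z, μ⟩)⁻¹ : Matrix.specialUnitaryGroup (Fin 2) ℂ) : Matrix (Fin 2) (Fin 2) ℂ)) x‖
        + ((F.P K).d : ℝ) * (2 * q * s + 4 * s * γ) := by
  have hs0 : 0 ≤ s := (norm_nonneg _).trans (hs ⟨x, ⟨0, (F.P K).hd⟩⟩)
  have hs' : ∀ b, ‖pertVar W (GaugeField.gaugeAct g (emb15 W (expHermField A₀))) b‖ ≤ 2 * s + q :=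
    fun b => (norm_pertVar_gaugeAct_emb15_le F W A₀ hA g hs hs1 b).trans (add_le_add le_rfl (hq b))
  -- the three fields
  set D : Fin (F.P K).d → Site (F.P K) 0 → Matrix (Fin 2) (Fin 2) ℂ :=
    fun μ z => (-Complex.I) • mlog ((GaugeField.gaugeAct g (emb15 W (expHermField A₀)) ⟨z, μ⟩ * (W ⟨z, μ⟩)⁻¹ : Matrix.specialUnitaryGroup (Fin 2) ℂ) : Matrix (Fin 2) (Fin 2) ℂ) with hD
  set Ad : Fin (F.P K).d → Site (F.P K) 0 → Matrix (Fin 2) (Fin 2) ℂ :=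
    fun μ z => ((g z : Matrix.specialUnitaryGroup (Fin 2) ℂ) : Matrix (Fin 2) (Fin 2) ℂ) * A₀ ⟨z, μ⟩ * star ((g z : Matrix.specialUnitaryGroup (Fin 2) ℂ) : Matrix (Fin 2) (Fin 2) ℂ) with hAd
  set G : Fin (F.P K).d → Site (F.P K) 0 → Matrix (Fin 2) (Fin 2) ℂ :=
    fun μ z => (-Complex.I) • mlog ((GaugeField.gaugeAct g W ⟨z, μ⟩ * (W ⟨z, μ⟩)⁻¹ : Matrix.specialUnitaryGroup (Fin 2) ℂ) : Matrix (Fin 2) (Fin 2) ℂ) with hG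
  have hR2 : ∀ μ z, ‖(D - (Ad + G)) μ z‖ ≤ 2 * s * γ := by
    intro μ z
    obtain ⟨hsplit, -⟩ := untwistChart_split_T3 (F := F) W A₀ hA hs g hs' hw ⟨z, μ⟩
    refine hsplit.trans ?_
    exact mul_le_mul (mul_le_mul_of_nonneg_left (hs _) (by norm_num)) (hγ _) (norm_nonneg _) (by positivity)
  have hlin : divB (torusT (F.P K) 0) (fun κ z => unitsField (toUField W) ⟨z, κ⟩) D x
      = divB (torusT (F.P K) 0) (fun κ z => unitsField (toUField W) ⟨z, κ⟩) Ad x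
        + divB (torusT (F.P K) 0) (fun κ z => unitsField (toUField W) ⟨z, κ⟩) G x
        + divB (torusT (F.P K) 0) (fun κ z => unitsField (toUField W) ⟨z, κ⟩) (D - (Ad + G)) x := by
    have e : D = Ad + G + (D - (Ad + G)) := by abel
    conv_lhs => rw [e]
    simp only [divB, Pi.add_apply, covDstar_add, Finset.sum_add_distrib]
  rw [hlin]
  have hdivR2 : ‖divB (torusT (F.P K) 0) (fun κ z => unitsField (toUField W) ⟨z, κ⟩) (D - (Ad + G)) x‖ ≤ ((F.P K).d : ℝ) * (4 * s * γ) := by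
    refine (norm_divB_le_sum F W _ x).trans ?_
    calc ∑ μ : Fin (F.P K).d, (‖(D - (Ad + G)) μ ((torusT (F.P K) 0 μ).symm x)‖ + ‖(D - (Ad + G)) μ x‖)
        ≤ ∑ _μ : Fin (F.P K).d, (2 * s * γ + 2 * s * γ) := Finset.sum_le_sum fun μ _ => add_le_add (hR2 μ _) (hR2 μ _)
      _ = ((F.P K).d : ℝ) * (4 * s * γ) := by rw [Finset.sum_const, Finset.card_univ, Fintype.card_fin, nsmul_eq_mul]; ring
  have hdivAd := norm_divB_conjGauge_le F W A₀ g x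
  have hcomm : 2 * ∑ μ : Fin (F.P K).d, ‖((GaugeField.gaugeAct g W ⟨(torusT (F.P K) 0 μ).symm x, μ⟩ * (W ⟨(torusT (F.P K) 0 μ).symm x, μ⟩)⁻¹ : Matrix.specialUnitaryGroup (Fin 2) ℂ) : Matrix (Fin 2) (Fin 2) ℂ) - 1‖
        * ‖A₀ ⟨(torusT (F.P K) 0 μ).symm x, μ⟩‖ ≤ ((F.P K).d : ℝ) * (2 * q * s) := by
    have hq0 : 0 ≤ q := (norm_nonneg _).trans (hq ⟨x, ⟨0, (F.P K).hd⟩⟩)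
    calc 2 * ∑ μ : Fin (F.P K).d, ‖((GaugeField.gaugeAct g W ⟨(torusT (F.P K) 0 μ).symm x, μ⟩ * (W ⟨(torusT (F.P K) 0 μ).symm x, μ⟩)⁻¹ : Matrix.specialUnitaryGroup (Fin 2) ℂ) : Matrix (Fin 2) (Fin 2) ℂ) - 1‖
          * ‖A₀ ⟨(torusT (F.P K) 0 μ).symm x, μ⟩‖
        ≤ 2 * ∑ _μ : Fin (F.P K).d, q * s := by
          refine mul_le_mul_of_nonneg_left (Finset.sum_le_sum fun μ _ => ?_) (by norm_num)
          exact mul_le_mul (hq _) (hs _) (norm_nonneg _) hq0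
      _ = ((F.P K).d : ℝ) * (2 * q * s) := by rw [Finset.sum_const, Finset.card_univ, Fintype.card_fin, nsmul_eq_mul]; ring
  have h1 := norm_add_le (divB (torusT (F.P K) 0) (fun κ z => unitsField (toUField W) ⟨z, κ⟩) Ad x + divB (torusT (F.P K) 0) (fun κ z => unitsField (toUField W) ⟨z, κ⟩) G x)
    (divB (torusT (F.P K) 0) (fun κ z => unitsField (toUField W) ⟨z, κ⟩) (D - (Ad + G)) x)
  have h2 := norm_add_le (divB (torusT (F.P K) 0) (fun κ z => unitsField (toUField W) ⟨z, κ⟩) Ad x) (divB (torusT (F.P K) 0) (fun κ z => unitsField (toUField W) ⟨z, κ⟩) G x)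
  nlinarith [h1, h2, hdivR2, hdivAd, hcomm]

end Divergence

end Summit.QuantumFields.YangMills.Theorems.Prop7GaugeActChartRows

end
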